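import Literature.AnabelianGeometry.EtaleTheta.Discharge.Sec4RootDivisors
import Literature.AnabelianGeometry.EtaleTheta.Discharge.Sec4Thm44

/-!
# [EtTh] Prop 4.3 (ii) — the named fact `Prop43_ii` ("bi-Kummer `N`-th roots are unique up to the
# conjugation operations (a), (b)") proved for the model Frobenioid; Thm 4.4 (iv) thereby unconditional

Mochizuki, *The étale theta function …*, Publ. RIMS **45** (2009), §4, Prop. 4.3 (ii), PDF p.91 (printed
p.317), proof p.91 [cite: MochizukiEtTh2009, Prop 4.3(ii) p.91]: "the collection of bi-Kummer `N`-th roots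
… is equal to the collection of pairs obtained from `(s'_N{}^{gp}, s''_N{}^{gp})` by (a) simultaneous
conjugation by an element `ζ_Aut ∈ O^×(B_N)`, followed by (b) non-simultaneous conjugation [of, say,
`s''_N{}^{gp}`, but not `s'_N{}^{gp}`] by an element `u ∈ μ_N(B_N)`"; printed proof: "Since … `s_N^triv` is
completely determined up to conjugation by an element of `O^×(A_N)`, [this] follows immediately by
applying the general theory of Frobenioids [the first equivalence of categories involving pre-steps of
[FrdI], Definition 1.3, (iii), (d); the fact that Frobenioids are always totally epimorphic]".

abc-iut cell, layer L2, node `EtTh:Prop4.3(ii)` (seat abc-iut-w5-d063; statement typed by abc-iut-L2-t3 as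
`BiKummerSetting.Prop43_ii` in `BiKummerRoots.lean`, v2+: the two bi-Kummer roots `K`, `K'` sit on the
SAME `N`-th root `R`, have the same identification `H_{A_N} ≅ H_{B_N}`, and have `O^×(A_N)`-conjugate
trivializing sections).  Over the setting `S : BiKummerSetting X T D VD`, whose Frobenioid
`C = S.tf.category` IS the model Frobenioid of [FrdI] Thm. 5.2 (i), the statement holds MODULO ONLY
`Φ` divisorial and `B` group-like ([FrdI] Thm. 5.2 (ii)), exactly by the printed argument: the unit
`ζ_A ∈ O^×(A_N)` conjugating the trivializing sections lifts UNIQUELY along the pre-step `s'_N` ([FrdI]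
Def. 1.3 (iii)(d) for the model — abc-iut-L6-t12's `NthRoot.existsUnique_aut_comp_num`; total
epimorphicity — `ModelFrobenioid.cancel_left_of_isIso_baseMap`) to `ζ := ζ_Aut ∈ O^×(B_N)`, and the same
`ζ` lifts `ζ_A` along `s''_N` (base-equivalent to `s'_N`; the rational-function part of a lifted unit is
forced), so that for two bi-Kummer roots of one and the same `N`-th root the (b)-twist is `u = 1 ∈ μ_N(B_N)`.
Consequence: abc-iut-L2-t3's `thm44_iv_of_prop43_ii` (`Discharge/Sec4Thm44.lean`: [EtTh] Thm. 4.4 (iv) ⇐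
Prop. 4.3 (ii)) becomes `thm44_iv_of`: Thm. 4.4 (iv) as typed, modulo [FrdI] Thm. 5.2 (ii) only.
HONEST FRAMING: nothing here asserts that such data exist for an actual curve; no side is taken on any
disputed claim.
-/

noncomputable section

namespace Literature.AlgebraicGeometry.Frobenioids

namespace ModelFrobenioid

open CategoryTheory Opposite

universe w v u

variable {D : Type u} [Category.{v} D] {Φ B : Dᵒᵖ ⥤ CommMonCat.{w}} {DivB : B ⟶ monoidGp Φ}

/-- **Lifted automorphisms along a base-isomorphism respect conjugation** (the "total epimorphicity"
step of the proof of [EtTh] Prop. 4.3 (ii), p.91): if `σ`, `σ'`, `ζ_Y ∈ Aut_C(Y)` lift `τ`, `τ'`,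
`ζ_X ∈ Aut_C(X)` along `s : X → Y` (`Base(s)` an isomorphism, so `s` is an epimorphism of `C`) and
`τ' = ζ_X τ ζ_X⁻¹`, then `σ' = ζ_Y σ ζ_Y⁻¹`. [cite: MochizukiFrdI2008, Thm. 5.2(ii) p.101] -/
theorem aut_conj_of_comp_eq (hΦd : Objectwise (fun M _ => IsDivisorial M) Φ)
    (hBg : Objectwise (fun M _ => IsGroupLike M) B) {X Y : ModelFrobenioid Φ B DivB} (s : X ⟶ Y)
    [IsIso (baseMap s)] {τ τ' ζX : Aut X} {σ σ' ζY : Aut Y} (hσ : s ≫ σ.hom = τ.hom ≫ s)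
    (hσ' : s ≫ σ'.hom = τ'.hom ≫ s) (hζ : s ≫ ζY.hom = ζX.hom ≫ s) (hτ : τ' = ζX * τ * ζX⁻¹) :
    σ' = ζY * σ * ζY⁻¹ := by
  have e1 : ζX.inv ≫ s = s ≫ ζY.inv := by
    rw [Iso.inv_comp_eq, ← Category.assoc, ← hζ, Category.assoc, Iso.hom_inv_id, Category.comp_id]
  apply Iso.ext
  apply cancel_left_of_isIso_baseMap hΦd hBg s
  rw [hσ', hτ]
  simp only [Aut.Aut_mul_def, Aut.Aut_inv_def, Iso.trans_hom, Iso.symm_hom, Category.assoc]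
  rw [← hζ, ← reassoc_of% hσ, reassoc_of% e1]

end ModelFrobenioid

end Literature.AlgebraicGeometry.Frobenioids

namespace Literature.AnabelianGeometry.EtaleTheta

open CategoryTheory Opposite Literature.AlgebraicGeometry.Frobenioids

universe u₀ v₀ u v w

variable {K : Type u₀} [Field K]

namespace BiKummerSetting

variable {X : SemiGraphs.TemperedArithmeticGroup.{u₀} K} {D₀ : Type u₀} [Category.{v₀} D₀]
  {V : FrdIMonoidStub.{w}} {T : RealifiedDivisorMonoids (D₀ := D₀) V} {D : Type u} [Category.{v} D]
  {VD : FrdICatStub.{u, v, w} D} {S : BiKummerSetting X T D VD}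

namespace NthRoot

variable {A Bo : S.C} {f : S.biratUnits A} {P : S.FractionPair f Bo} {N : ℕ+}
  {pullFrac : ∀ {A A' : S.C} (_ : A' ⟶ A), S.biratUnits A → S.biratUnits A'}
  (R : S.NthRoot f P N pullFrac)

/-- **A unit of the `N`-domain lifts to a unit of the `N`-codomain along BOTH `s'_N` and `s''_N`** (proof of
Prop. 4.3 (ii), p.91: "the first equivalence of categories involving pre-steps of [FrdI], Definition 1.3,
(iii), (d)"): for `ζ_A ∈ O^×(A_N)` there is `ζ ∈ O^×(B_N)` with `ζ ∘ s'_N = s'_N ∘ ζ_A` and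
`ζ ∘ s''_N = s''_N ∘ ζ_A` — the lift along `s'_N` is the one of [FrdI] Def. 1.3 (iii)(d)
(`existsUnique_aut_comp_num`), it is a base-identity linear automorphism, and its rational function is
`(Base s'_N)_* u_{ζ_A}`, which is also what a lift along the base-equivalent `s''_N` requires (`Φ`
divisorial, `B` group-like). [cite: MochizukiEtTh2009, Prop 4.3(ii) p.91] -/
theorem exists_units_lift (hΦd : Objectwise (fun M _ => IsDivisorial M) S.tf.divisorMonoid)
    (hBg : Objectwise (fun M _ => IsGroupLike M) S.tf.ratFnFunctor) {ζA : Aut R.AN}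
    (hζA : ζA ∈ S.units R.AN) :
    ∃ ζB : Aut R.BN, ζB ∈ S.units R.BN ∧ R.pair.num ≫ ζB.hom = ζA.hom ≫ R.pair.num ∧
      R.pair.den ≫ ζB.hom = ζA.hom ≫ R.pair.den := by
  haveI : IsIso (ModelFrobenioid.baseMap R.pair.num) := R.pair.isPreStep_num.2
  haveI : IsIso (ModelFrobenioid.baseMap R.pair.den) := R.pair.isPreStep_den.2
  haveI : IsCancelMul (S.tf.ratFnFunctor.obj (op R.AN.base)) :=
    isIntegral_iff_isCancelMul.mp (hBg R.AN.base).isPreDivisorial.isIntegral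
  have hζAb : ModelFrobenioid.baseMap ζA.hom = 𝟙 _ := hζA.1
  have hζAd : ModelFrobenioid.degFr ζA.hom = 1 := hζA.2
  have hn1 : ModelFrobenioid.degFr R.pair.num = 1 := R.pair.isPreStep_num.1
  have hd1 : ModelFrobenioid.degFr R.pair.den = 1 := R.pair.isPreStep_den.1
  have hbP : ModelFrobenioid.baseMap R.pair.num = ModelFrobenioid.baseMap R.pair.den := R.pair.base_eq
  have hfix : pull S.tf.divisorMonoid (ModelFrobenioid.baseMap ζA.hom) (ModelFrobenioid.div R.pair.num) =
      ModelFrobenioid.div R.pair.num := by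
    rw [hζAb, pull_id]
  obtain ⟨ζB, hζB, -⟩ := R.existsUnique_aut_comp_num hΦd hBg ζA hfix
  have hζBb : ModelFrobenioid.baseMap ζB.hom = 𝟙 _ := by
    have e := congrArg ModelFrobenioid.baseMap hζB
    rw [ModelFrobenioid.baseMap_comp, ModelFrobenioid.baseMap_comp, hζAb, Category.id_comp] at e
    exact (cancel_epi (ModelFrobenioid.baseMap R.pair.num)).mp (e.trans (Category.comp_id _).symm)
  have hζBd : ModelFrobenioid.degFr ζB.hom = 1 := ModelFrobenioid.degFr_eq_one_of_isIso ζB.hom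
  have hζBu : ζB ∈ S.units R.BN := ⟨hζBb, hζBd⟩
  have hunit : pull S.tf.ratFnFunctor (ModelFrobenioid.baseMap R.pair.num) (ModelFrobenioid.unit ζB.hom) =
      ModelFrobenioid.unit ζA.hom := by
    have e := congrArg ModelFrobenioid.unit hζB
    rw [ModelFrobenioid.unit_comp_pull, ModelFrobenioid.unit_comp_pull, hζBd, hζAb, pull_id, hn1, PNat.one_coe,
      pow_one, pow_one, mul_comm] at e
    exact mul_left_cancel e
  refine ⟨ζB, hζBu, hζB, ?_⟩
  apply ModelFrobenioid.hom_ext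
  · rw [ModelFrobenioid.degFr_comp, ModelFrobenioid.degFr_comp, hζBd, hζAd, one_mul, mul_one]
  · rw [ModelFrobenioid.baseMap_comp, ModelFrobenioid.baseMap_comp, hζBb, hζAb, Category.comp_id,
      Category.id_comp]
  · rw [ModelFrobenioid.div_comp_pull, ModelFrobenioid.div_comp_pull, ModelFrobenioid.div_eq_one_of_isIso hΦd ζB.hom,
      ModelFrobenioid.div_eq_one_of_isIso hΦd ζA.hom, map_one, one_mul, one_pow, mul_one, hζBd, PNat.one_coe,
      pow_one, hζAb, pull_id]
  · rw [ModelFrobenioid.unit_comp_pull, ModelFrobenioid.unit_comp_pull, ← hbP, hunit, hζBd, hζAb, pull_id, hd1,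
      PNat.one_coe, pow_one, pow_one, mul_comm]

end NthRoot

/-! ### Proposition 4.3 (ii) -/

/-- **[EtTh] Proposition 4.3 (ii) — the named fact `Prop43_ii` PROVED for the model Frobenioid** (p.91),
modulo only `Φ` divisorial and `B` group-like ([FrdI] Thm. 5.2 (ii)): two bi-Kummer `N`-th roots `K`, `K'`
of the same `N`-th root with the same identification `H_{A_N} ≅ H_{B_N}` and `O^×(A_N)`-conjugate
trivializing sections (`s_N^triv{}' = ζ_A s_N^triv ζ_A⁻¹`) satisfy `s'{}^{gp}{}' = ζ s'{}^{gp} ζ⁻¹`,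
`s''{}^{gp}{}' = (u ζ) s''{}^{gp} (u ζ)⁻¹` with `ζ ∈ O^×(B_N)` the lift of `ζ_A` along `s'_N` (and `s''_N`)
and `u = 1 ∈ μ_N(B_N)` — "follows immediately by applying … [FrdI], Definition 1.3, (iii), (d); the fact
that Frobenioids are always totally epimorphic". [cite: MochizukiEtTh2009, Prop 4.3(ii) p.91] -/
theorem prop43_ii_of (hΦd : Objectwise (fun M _ => IsDivisorial M) S.tf.divisorMonoid)
    (hBg : Objectwise (fun M _ => IsGroupLike M) S.tf.ratFnFunctor)
    (pullFrac : ∀ {A A' : S.C} (_ : A' ⟶ A), S.biratUnits A → S.biratUnits A') :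
    S.Prop43_ii pullFrac := by
  intro A Bo f P N R hA hB K K' hident hstriv _
  obtain ⟨ζA, hconjA⟩ := hstriv
  obtain ⟨ζB, hζBu, hnum, hden⟩ := R.exists_units_lift hΦd hBg ζA.2
  haveI : IsIso (ModelFrobenioid.baseMap R.pair.num) := R.pair.isPreStep_num.2
  haveI : IsIso (ModelFrobenioid.baseMap R.pair.den) := R.pair.isPreStep_den.2
  have h1 : (1 : Aut R.BN) ∈ S.mu R.BN N := ⟨(S.units R.BN).one_mem, one_pow _⟩
  refine ⟨⟨ζB, hζBu⟩, ⟨1, h1⟩, fun h => ?_⟩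
  obtain ⟨g, rfl⟩ := K.ident.surjective h
  have hg' : K'.ident g = K.ident g := by rw [hident]
  constructor
  · show K'.sNum (K.ident g) = ζB * K.sNum (K.ident g) * ζB⁻¹
    have c' := K'.comm_num g
    rw [hg'] at c'
    exact ModelFrobenioid.aut_conj_of_comp_eq hΦd hBg R.pair.num (K.comm_num g) c' hnum (hconjA g)
  · show K'.sDen (K.ident g) = ((1 : Aut R.BN) * ζB) * K.sDen (K.ident g) * ((1 : Aut R.BN) * ζB)⁻¹
    rw [one_mul]
    have c' := K'.comm_den g
    rw [hg'] at c'
    exact ModelFrobenioid.aut_conj_of_comp_eq hΦd hBg R.pair.den (K.comm_den g) c' hden (hconjA g)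

/-! ### Theorem 4.4 (iv), now modulo [FrdI] Thm 5.2 (ii) only -/

section Theorem44

variable {K' : Type u₀} [Field K'] {X₁ : SemiGraphs.TemperedArithmeticGroup.{u₀} K}
  {X₂ : SemiGraphs.TemperedArithmeticGroup.{u₀} K'} {D₀' : Type u₀} [Category.{v₀} D₀']
  {T₁ : RealifiedDivisorMonoids (D₀ := D₀) V} {T₂ : RealifiedDivisorMonoids (D₀ := D₀') V}
  {D₁ D₂ : Type u} [Category.{v} D₁] [Category.{v} D₂] {VD₁ : FrdICatStub.{u, v, w} D₁}
  {VD₂ : FrdICatStub.{u, v, w} D₂} {S₁ : BiKummerSetting X₁ T₁ D₁ VD₁} {S₂ : BiKummerSetting X₂ T₂ D₂ VD₂}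

/-- **[EtTh] Theorem 4.4 (iv)** as typed (`Thm44_iv`, p.94: "`Ψ` is compatible with bi-Kummer `N`-th roots"
up to the conjugation operations (a), (b) of Prop. 4.3 (ii)), from abc-iut-L2-t3's reduction
`thm44_iv_of_prop43_ii` and `prop43_ii_of`: it holds for the settings of §4 modulo only `Φ₂` divisorial and
`B₂` group-like ([FrdI] Thm. 5.2 (ii)). [cite: MochizukiEtTh2009, Thm 4.4(iv) p.94] -/
theorem thm44_iv_of (h : Thm44Hyp S₁ S₂)
    (ψ : ∀ A : S₁.C, S₁.biratUnits A ≃* S₂.biratUnits (h.Ψ.functor.obj A))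
    (pullFrac₁ : ∀ {A A' : S₁.C} (_ : A' ⟶ A), S₁.biratUnits A → S₁.biratUnits A')
    (pullFrac₂ : ∀ {A A' : S₂.C} (_ : A' ⟶ A), S₂.biratUnits A → S₂.biratUnits A')
    (hΦd : Objectwise (fun M _ => IsDivisorial M) S₂.tf.divisorMonoid)
    (hBg : Objectwise (fun M _ => IsGroupLike M) S₂.tf.ratFnFunctor) :
    Thm44_iv h ψ pullFrac₁ pullFrac₂ :=
  thm44_iv_of_prop43_ii h ψ pullFrac₁ pullFrac₂ (prop43_ii_of hΦd hBg pullFrac₂)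

end Theorem44

end BiKummerSetting

end Literature.AnabelianGeometry.EtaleTheta

end
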